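import Mathlib.Analysis.InnerProductSpace.PiL2
import Literature.MathematicalPhysics.StatisticalMechanics.LennardJonesClusters
import HarnessLib

/-!
# Line `two-tolerance-sandwich` (crux `PricedLinkCensus.ChargedEnergyGap`, stmt-AtomisticToContinuum-14231): the isolated-site bound

Stub `stub_isolatedSite` of the line skeleton.  In a `1/3`-separated configuration
`y : Fin N → ℝ³`, a site `i` all of whose other sites are at distance `≥ 16` has Lennard-Jones
site energy `𝓔ⁱ(y) = ∑_{k ≠ i} V_LJ(|yᵢ − y_k|) ≥ −1/10`
(`V_LJ(r) = r⁻¹²/12 − r⁻⁶/6`, `Literature.MathematicalPhysics.StatisticalMechanics.lennardJones`).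

Proof (shell sum, the pattern of `sum_inv_pow_six_le`).  Termwise `V_LJ(d) ≥ −d⁻⁶/6`, so it
suffices to show `∑_{k ≠ i} |yᵢ − y_k|⁻⁶ ≤ 3/5`.  Group the sites `k ≠ i` by the unit shell
index `b = ⌊|yᵢ − y_k|⌋ ≥ 16`.  The sites of shell `b` lie in the closed ball of radius `b + 1`
about `yᵢ` and are `1/3`-separated, so by the packing bound `card_le_of_separated_of_dist_le`
they number at most `(6(b+1)+1)³ = (6b+7)³ ≤ 267·b³` (as `b ≥ 16`), each contributing `≤ b⁻⁶`:
the shell contributes `≤ 267/b³ ≤ 267/((b−1)b(b+1))`, and the telescoping sum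
`∑_{b ≥ 16} 1/((b−1)b(b+1)) = 1/(2·15·16) = 1/480` gives the total `≤ 267/480 < 3/5`.
Finally `𝓔ⁱ ≥ −(1/6)·(3/5) = −1/10`.  All `[folklore]`.
-/

noncomputable section

namespace Summit.AtomisticToContinuum.Crystallization.Theorems.TwoToleranceSandwichIsolatedSite

open scoped BigOperators
open Module Literature.MathematicalPhysics.StatisticalMechanics

/-- Telescoping: `∑_{16 ≤ b < n} 1/((b−1)b(b+1)) = 1/480 − 1/(2(n−1)n)` for `n ≥ 16`.
[folklore] -/
theorem sum_Ico_inv_cube_telescope (n : ℕ) (hn : 16 ≤ n) :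
    ∑ b ∈ Finset.Ico 16 n, (1 : ℝ) / (((b : ℝ) - 1) * b * (b + 1)) =
      1 / 480 - 1 / (2 * ((n : ℝ) - 1) * n) := by
  induction n, hn using Nat.le_induction with
  | base => norm_num
  | succ n hn ih =>
    rw [Finset.sum_Ico_succ_top hn, ih]
    have h16 : (16 : ℝ) ≤ n := by exact_mod_cast hn
    have h1 : (n : ℝ) - 1 ≠ 0 := ne_of_gt (by linarith)
    have h2 : (n : ℝ) ≠ 0 := ne_of_gt (by linarith)
    have h3 : (n : ℝ) + 1 ≠ 0 := ne_of_gt (by linarith)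
    have key : 1 / (2 * ((n : ℝ) - 1) * n) - 1 / (((n : ℝ) - 1) * n * (n + 1)) =
        1 / (2 * (n : ℝ) * (n + 1)) := by
      rw [div_sub_div _ _ (mul_ne_zero (mul_ne_zero two_ne_zero h1) h2)
        (mul_ne_zero (mul_ne_zero h1 h2) h3),
        div_eq_div_iff (mul_ne_zero (mul_ne_zero (mul_ne_zero two_ne_zero h1) h2)
          (mul_ne_zero (mul_ne_zero h1 h2) h3)) (mul_ne_zero (mul_ne_zero two_ne_zero h2) h3)]
      ring
    have hc : ((n + 1 : ℕ) : ℝ) - 1 = n := by push_cast; ring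
    rw [hc]
    push_cast
    linear_combination -key

/-- The tail of `∑ b⁻³` from `16`: for every finite set `t` of natural numbers `≥ 16`,
`∑_{b ∈ t} b⁻³ ≤ 1/480` (via `b⁻³ ≤ 1/((b−1)b(b+1))` and telescoping). [folklore] -/
theorem sum_inv_cube_le (t : Finset ℕ) (ht : ∀ b ∈ t, 16 ≤ b) :
    ∑ b ∈ t, ((b : ℝ) ^ 3)⁻¹ ≤ 1 / 480 := by
  set n : ℕ := max 16 (t.sup id + 1) with hn_def
  have hn : 16 ≤ n := le_max_left _ _
  have hsub : t ⊆ Finset.Ico 16 n := fun b hb =>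
    Finset.mem_Ico.2 ⟨ht b hb,
      lt_of_lt_of_le (Nat.lt_succ_of_le (Finset.le_sup (f := id) hb)) (le_max_right _ _)⟩
  have hpos : ∀ b ∈ Finset.Ico 16 n, (0 : ℝ) < ((b : ℝ) - 1) * b * (b + 1) := fun b hb => by
    have h16 : (16 : ℝ) ≤ b := by exact_mod_cast (Finset.mem_Ico.1 hb).1
    have : (0 : ℝ) < (b : ℝ) - 1 := by linarith
    positivity
  have hn16 : (16 : ℝ) ≤ n := by exact_mod_cast hn
  have htail : (0 : ℝ) ≤ 1 / (2 * ((n : ℝ) - 1) * n) := by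
    have : (0 : ℝ) < (n : ℝ) - 1 := by linarith
    positivity
  calc ∑ b ∈ t, ((b : ℝ) ^ 3)⁻¹ ≤ ∑ b ∈ t, (1 : ℝ) / (((b : ℝ) - 1) * b * (b + 1)) := by
        refine Finset.sum_le_sum fun b hb => ?_
        have h16 : (16 : ℝ) ≤ b := by exact_mod_cast ht b hb
        have hb1 : (0 : ℝ) < (b : ℝ) - 1 := by linarith
        rw [← one_div, div_le_div_iff₀ (by positivity) (by positivity)]
        nlinarith
    _ ≤ ∑ b ∈ Finset.Ico 16 n, (1 : ℝ) / (((b : ℝ) - 1) * b * (b + 1)) :=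
        Finset.sum_le_sum_of_subset_of_nonneg hsub fun b hb _ => (div_pos one_pos (hpos b hb)).le
    _ = 1 / 480 - 1 / (2 * ((n : ℝ) - 1) * n) := sum_Ico_inv_cube_telescope n hn
    _ ≤ 1 / 480 := sub_le_self _ htail

/-- **Isolated shell sum.** If all mutual distances in `y : Fin N → ℝ³` are `≥ 1/3` and every site
`k ≠ i` is at distance `≥ 16` from `yᵢ`, then `∑_{k ≠ i} |yᵢ − y_k|⁻⁶ ≤ 3/5`: the unit shell
`⌊|yᵢ − y_k|⌋ = b` (`b ≥ 16`) holds at most `(6b+7)³ ≤ 267 b³` sites by the packing bound,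
each contributing `≤ b⁻⁶`, and `∑_{b ≥ 16} b⁻³ ≤ 1/480`. [folklore] -/
theorem sum_inv_pow_six_le_of_isolated {N : ℕ} (y : Fin N → EuclideanSpace ℝ (Fin 3))
    (i : Fin N) (hsep : ∀ j k : Fin N, j ≠ k → (1 / 3 : ℝ) ≤ dist (y j) (y k))
    (hfar : ∀ j : Fin N, j ≠ i → (16 : ℝ) ≤ dist (y i) (y j)) :
    ∑ k ∈ Finset.univ.erase i, (dist (y i) (y k))⁻¹ ^ 6 ≤ 3 / 5 := by
  set s := Finset.univ.erase i with hs_def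
  set m : Fin N → ℕ := fun k => ⌊dist (y i) (y k)⌋₊ with hm
  set t := s.image m with ht_def
  have hmem : ∀ k ∈ s, m k ∈ t := fun k hk => Finset.mem_image_of_mem m hk
  have hks : ∀ k ∈ s, (16 : ℝ) ≤ dist (y i) (y k) := fun k hk =>
    hfar k (Finset.ne_of_mem_erase hk)
  have hm16 : ∀ k ∈ s, 16 ≤ m k := fun k hk => Nat.le_floor (by exact_mod_cast hks k hk)
  have hmle : ∀ k ∈ s, (m k : ℝ) ≤ dist (y i) (y k) := fun k _ => Nat.floor_le dist_nonneg
  have hmlt : ∀ k ∈ s, dist (y i) (y k) < (m k : ℝ) + 1 := fun k _ => Nat.lt_floor_add_one _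
  -- termwise: `|yᵢ - y_k|⁻⁶ ≤ m_k⁻⁶`
  have step1 : ∑ k ∈ s, (dist (y i) (y k))⁻¹ ^ 6 ≤ ∑ k ∈ s, ((m k : ℝ))⁻¹ ^ 6 := by
    refine Finset.sum_le_sum fun k hk => ?_
    have h0 : (0 : ℝ) < m k := by
      have h16 : (16 : ℝ) ≤ m k := by exact_mod_cast hm16 k hk
      linarith
    exact pow_le_pow_left₀ (inv_nonneg.2 dist_nonneg) (inv_anti₀ h0 (hmle k hk)) _
  -- regroup by shells
  have step2 : ∑ k ∈ s, ((m k : ℝ))⁻¹ ^ 6 =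
      ∑ b ∈ t, ((s.filter fun k => m k = b).card : ℝ) * ((b : ℝ))⁻¹ ^ 6 := by
    have := Finset.sum_fiberwise_of_maps_to' hmem (fun b : ℕ => ((b : ℝ))⁻¹ ^ 6)
    simp only [Finset.sum_const, nsmul_eq_mul] at this
    exact this.symm
  -- each shell holds at most `(6b+7)³` sites
  have step3 : ∀ b ∈ t, ((s.filter fun k => m k = b).card : ℝ) ≤ (6 * (b : ℝ) + 7) ^ 3 := by
    intro b _
    set F := s.filter fun k => m k = b with hF
    have h3 : (0 : ℝ) < 1 / 3 := by norm_num
    have hinj : Set.InjOn y F := fun k _ l _ hkl => by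
      by_contra hne
      have := hsep k l hne
      rw [hkl, dist_self] at this
      norm_num at this
    rw [← Finset.card_image_of_injOn hinj]
    have hR : (0 : ℝ) ≤ (b : ℝ) + 1 := by positivity
    have := card_le_of_separated_of_dist_le (F.image y) (y i) h3 hR ?_ ?_
    · rw [finrank_euclideanSpace_fin] at this
      convert this using 2
      ring
    · intro c hc
      obtain ⟨k, hk, rfl⟩ := Finset.mem_image.1 hc
      obtain ⟨hks', hkb⟩ := Finset.mem_filter.1 hk
      rw [dist_comm]
      have := hmlt k hks'
      rw [hkb] at this
      exact this.le
    · intro c hc c' hc' hne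
      obtain ⟨k, -, rfl⟩ := Finset.mem_image.1 hc
      obtain ⟨l, -, rfl⟩ := Finset.mem_image.1 hc'
      exact hsep k l fun h => hne (h ▸ rfl)
  -- numerics per shell: `(6b+7)³ b⁻⁶ ≤ 267 b⁻³` for `b ≥ 16`
  have step4 : ∀ b ∈ t, (6 * (b : ℝ) + 7) ^ 3 * ((b : ℝ))⁻¹ ^ 6 ≤ 267 * ((b : ℝ) ^ 3)⁻¹ := by
    intro b hb
    obtain ⟨k, hk, rfl⟩ := Finset.mem_image.1 hb
    have hb16 : (16 : ℝ) ≤ (m k : ℝ) := by exact_mod_cast hm16 k hk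
    set β : ℝ := (m k : ℝ)
    have hβ : 0 < β := by linarith
    rw [inv_pow, ← div_eq_mul_inv, ← div_eq_mul_inv,
      div_le_div_iff₀ (by positivity) (by positivity)]
    have h5 : (16 * (6 * β + 7)) ^ 3 ≤ (103 * β) ^ 3 :=
      pow_le_pow_left₀ (by positivity) (by linarith) 3
    nlinarith [mul_le_mul_of_nonneg_right h5 (pow_nonneg hβ.le 3), pow_nonneg hβ.le 6]
  -- `∑_{b ∈ t} b⁻³ ≤ 1/480`
  have step5 : ∑ b ∈ t, ((b : ℝ) ^ 3)⁻¹ ≤ 1 / 480 :=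
    sum_inv_cube_le t fun b hb => by
      obtain ⟨k, hk, rfl⟩ := Finset.mem_image.1 hb
      exact hm16 k hk
  calc ∑ k ∈ s, (dist (y i) (y k))⁻¹ ^ 6
      ≤ ∑ b ∈ t, ((s.filter fun k => m k = b).card : ℝ) * ((b : ℝ))⁻¹ ^ 6 :=
        step1.trans_eq step2
    _ ≤ ∑ b ∈ t, (6 * (b : ℝ) + 7) ^ 3 * ((b : ℝ))⁻¹ ^ 6 :=
        Finset.sum_le_sum fun b hb => mul_le_mul_of_nonneg_right (step3 b hb) (by positivity)
    _ ≤ ∑ b ∈ t, 267 * ((b : ℝ) ^ 3)⁻¹ := Finset.sum_le_sum step4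
    _ = 267 * ∑ b ∈ t, ((b : ℝ) ^ 3)⁻¹ := by rw [Finset.mul_sum]
    _ ≤ 267 * (1 / 480) := mul_le_mul_of_nonneg_left step5 (by norm_num)
    _ ≤ 3 / 5 := by norm_num

/-- **STUB B — isolated site** of line `two-tolerance-sandwich`: in a `1/3`-separated
configuration in `ℝ³`, a site with every other site at distance `≥ 16` has Lennard-Jones site
energy `≥ −1/10` (termwise `V_LJ(d) ≥ −d⁻⁶/6` and the isolated shell sum
`∑_{k ≠ i} |yᵢ − y_k|⁻⁶ ≤ 3/5`). [folklore] -/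
theorem stub_isolatedSite : ∀ (N : ℕ) (y : Fin N → EuclideanSpace ℝ (Fin 3)) (i : Fin N), (∀ j k : Fin N, j ≠ k → (1 / 3 : ℝ) ≤ dist (y j) (y k)) → (∀ j : Fin N, j ≠ i → (16 : ℝ) ≤ dist (y i) (y j)) → -(1 / 10 : ℝ) ≤ Literature.MathematicalPhysics.StatisticalMechanics.siteEnergy Literature.MathematicalPhysics.StatisticalMechanics.lennardJones y i := by
  intro N y i hsep hfar
  have hsum := sum_inv_pow_six_le_of_isolated y i hsep hfar
  have hterm : ∀ k ∈ Finset.univ.erase i,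
      -(1 / 6 : ℝ) * (dist (y i) (y k))⁻¹ ^ 6 ≤ lennardJones (dist (y i) (y k)) := by
    intro k _
    unfold lennardJones
    have : (0 : ℝ) ≤ 1 / 12 * (dist (y i) (y k))⁻¹ ^ 12 := by positivity
    linarith
  unfold siteEnergy
  calc -(1 / 10 : ℝ) ≤ -(1 / 6 : ℝ) * ∑ k ∈ Finset.univ.erase i, (dist (y i) (y k))⁻¹ ^ 6 := by
        linarith
    _ = ∑ k ∈ Finset.univ.erase i, -(1 / 6 : ℝ) * (dist (y i) (y k))⁻¹ ^ 6 := by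
        rw [Finset.mul_sum]
    _ ≤ ∑ k ∈ Finset.univ.erase i, lennardJones (dist (y i) (y k)) := Finset.sum_le_sum hterm

end Summit.AtomisticToContinuum.Crystallization.Theorems.TwoToleranceSandwichIsolatedSite

end
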